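import Summits.QuantumFields.BalabanUV.Beta.GAN24.CombEVHWordsZeroStep

/-!
# `BalabanUV.Beta.GAN24.CombEVHSwapWordZeroStep` — binder row G-an2-4 ∕ (CONV-C), TRANSFER-III, the (III′) (C)-campaign's supplier `hB0` AT LEVELS `j + 1 ≥ 1`:
# **(27) AT THE COMB DATA, LEVEL `j+1`, THE SWAP WORD** — companion of `CombEVHWordsZeroStep` (same gen, same route): the `VH′_{u′} ⊗ E′_c` word with the transported border on the
# LATTICE bond (left) and the transported cubic sector `𝒯(c₀ • e3OfK Lc G_j M)` of a generic local, block-covariant member `M` with parity-odd rows on the CELL bond (right) vanishes in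
# the zero mode as soon as the `β`-read exit-face current of the UNTRANSPORTED cubic sector is divergence-free (D) with zero cell totals (Z) — leaf-01 g86 D2
# `CombBorderWordsZero.sum_box_transported_border_wilson_swap_word_eq_zero`'s route token for token with the cubic sector in place of `cE • wilsonA`, closed by
# `CombEVHWordsZeroStep.sum_box_leftFamily_face_eq_zero_of_divFree` with the left face `β`; at the comb data (an1's record, `M = 𝒯 S̃comb_j`) (D)_comb is leaf-01 g87's K §3, (Z)_comb is OPEN
# (G-an2-4 ∕ (CONV-C) OWNER `b2b-balaban-gan24-p1`, gen 53; journal [GAN24P1-G53-INTENT-1])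

NOT IN PRINT; OUR BOOKKEEPING ([folklore] BY NAME over leaf-01 g86 A1 `TransportedWordTools` ∕ D1 `CombBorderWordTools` ∕ D2's swap route ∕ C `CombVHEWordsZeroStep` §1 ∕ §3, leaf-04's
`VHWordsZeroCell` ∕ `VHWordsZeroBorder`, this gen's `CombEVHWordsZeroStep` §1; 0 `def`, 0 cited fact, 0 `def … : Prop`, 0 sorry).
HONEST FRAMING (cell contract, verbatim): «discharging `BetaPertH` makes Bałaban's UV stability UNCONDITIONAL — a real constructive-QFT result; it is NOT the continuum limit and NOT
the Clay problem.»  HONEST DEPENDENCY (verbatim): «continuum YM on T⁴ ⇐ BetaPertH ∧ nine spine estimates (0/9 proved); BetaPertH ⇐ (D1) ∧ (D4) ∧ CAP+tail; G-an2-4 gates asym, D1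
and NE2/3/4.»

## What is proved (generic `d`, `[NeZero Lc]`, `1 ≤ Lc`, in-block kernel root `toSite rb`, `G_j = coDressKBmAt (toSite rb) Lc (KInvStep Lc j)`, `X̃♮_{j+1}`, `T := κ t ↦ c₀ • e3OfK Lc G_j M κ t`, all units)
* §1 ANY transport root `r ∈ box`, border `S′` local ∕ no ff block ∕ block-covariant ∕ multiplier SECOND legs coarse:
  **`sum_box_transported_border_sector_swap_word_eq_zero_of_divFree`** — `Σ_{c ∈ box Lc} Σ'_{u′} FF[(vertexOfK X̃♮_{j+1} Lc (unitS (𝒯S′)) ν u′ ∘ X̃♮_{j+1}) ∘ vertexOfK X̃♮_{j+1} Lc (unitS (𝒯T)) μ c] = 0`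
  GIVEN (D)∕(Z) on the `β`-read current of `V^T_μ` (transposition: A1 `trK_vertexOfK_unitS_slotPsiS` on C `sector_antisymm`, `trK_sandwich_dressedStep ∕ sgnK_sandwich`; negated charges D1
  `hasSum_sandwich_sgnK_dressedStep_fm_col`; D1 §2 ∕ §3; the cell identity with the left face `β`).
* §2 AT THE COMB DATA (`r = rb = ctrOff (d+1) Lc`, an1's record, `M = 𝒯 (ScombOf tabs cE cVH cΛ j)`, `c₀ = cE·wE_{j+1}`, border `c • symVhSAt ρ_c`):
  **`comb_VHe_swap_word_succ_eq_zero_of_divFree`** — F6 `dM_comb_succ_split`'s `V^VH′_{u′} ⊗ V^E′_cb` swap word at level `j+1` vanishes in the zero mode GIVEN (D)_comb ∧ (Z)_comb on the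
  `β`-read current (displayed `hdiv'`, `h0'`; (D)_comb := K §3 at `(ν, β) := (μ, β)`).
WHAT THIS IS NOT: (Z)_comb is NOT proved; NO value; NOT `hB0`; NEVER «G-an2-4 closed» as (CONV-C); NOT D1, NOT `BetaPertH`, NOT continuum, NOT Clay.  2026-08-27; no existing file touched.
-/

noncomputable section

open Finset
open scoped BigOperators
open Literature.MathematicalPhysics.QuantumFieldTheory
open Literature.MathematicalPhysics.QuantumFieldTheory.Balaban1983to89
open Literature.MathematicalPhysics.QuantumFieldTheory.Balaban1983to89.Beta
open ExpKernelCalculus (Site MKer comp shiftK Decays BiLoc VertexFamily)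
open BalabanStepJetsSucc (biLoc_comp_right wE)
open AffineAveraging (box toSite unitVec)
open AveragingContours (off)
open AveragingContoursRooted (ctr ctrOff ctrOff_mem_box)
open OneStepResolventKernel (Fib LocStencil decays_mono biLoc_mono)
open OneStepKernelFamily (KInvStep vertexOfK vertexFamily_vertexOfK decays_KInvStep)
open StepJetData (locStencil_smul)
open PeriodicDescent (IsPeriodic)
open Summit.QuantumFields.BalabanUV.Beta.TameKernelCalculus (trK trK_apply trK_comp biLoc_trK Loc Spr Tame comp_assoc_tame comp_neg_left decays_trK)
open Summit.QuantumFields.BalabanUV.Beta.BorderedHessian (sgnK decays_sgnK)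
open Summit.QuantumFields.BalabanUV.Beta.AxialDressingRooted (coDressKBmAt decays_coDressKBmAt)
open Summit.QuantumFields.BalabanUV.Beta.HessKerDressedUnits (unitK unitS decays_unitK locStencil_unitS)
open Summit.QuantumFields.BalabanUV.Beta.SpineRooted (e3OfK)
open Summit.QuantumFields.BalabanUV.Beta.SymAveragingHessianCounts (symVhSAt)
open Summit.QuantumFields.BalabanUV.Beta.SymSecondOrderTablesAn1 (symTablesAn1S2)
open Summit.QuantumFields.BalabanUV.Beta.CombChartStepJets (ScombOf)
open Summit.QuantumFields.BalabanUV.Beta.SymCorrectorKernel (psiKS spr_psiKS)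
open Summit.QuantumFields.BalabanUV.Beta.SymCorrectorFace (slotPsiS slotPsiS_shift)
open Summit.QuantumFields.BalabanUV.Beta.SymCorrectorSockets (locStencil_slotPsiS)
open Summit.QuantumFields.BalabanUV.Beta.GAN24.ExchangeSlotResum (face_weight_periodic tsum_twoFace_eq_trK)
open Summit.QuantumFields.BalabanUV.Beta.GAN24.VHWordsZeroBorder (borderSlot_translate borderSlot_inr_fst_eq_zero borderSlot_inr_snd_eq_zero)
open Summit.QuantumFields.BalabanUV.Beta.GAN24.VHWordsZeroCell (tsum_ffLeft_profile_right_word_eq sum_fmCharge_mul sum_neg_fmCharge_mul)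
open Summit.QuantumFields.BalabanUV.Beta.GAN24.VHWordsZeroLatticeStep (current_bounded)
open Summit.QuantumFields.BalabanUV.Beta.GAN24.ExitFaceLeftFamily (leftFamily_cov_of_translate summable_leftFamily_mul_of_locStencil tsum_leftFamily_eq_faceface)
open Summit.QuantumFields.BalabanUV.Beta.GAN24.ExitFaceCurrentCellTotals (tsum_weight_current_eq_faceSlot)
open Summit.QuantumFields.BalabanUV.Beta.GAN24.PeriodicCurrentFaceFlux (sum_box_face_current_eq_zero)
open Summit.QuantumFields.BalabanUV.Beta.GAN24.CoarseBondCellPairing (sum_box_tsum_sum_mul_periodic_of_cov)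
open Summit.QuantumFields.BalabanUV.Beta.GAN24.CombTransportedBorder (pos_Lc locStencil_symVhS symVhS_inl_inl symVhS_translate symVhS_inr_fst_eq_zero symVhS_inr_snd_eq_zero)
open Summit.QuantumFields.BalabanUV.Beta.GAN24.CombBorderWordsZero (slotPsiS_inr_fst_supp slotPsiS_inr_snd_supp)
open Summit.QuantumFields.BalabanUV.Beta.GAN24.CombSlotResumTransport (vertexOfK_unitS_transport_eq_conj)
open Summit.QuantumFields.BalabanUV.Beta.GAN24.TransportedWordTools (exists_decays_sandwich spr_sandwich tsum_twoFace_conj_word_eq trK_vertexOfK_unitS_slotPsiS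
  vertexOfK_unitS_slotPsiS_entry_eq_zero trK_sandwich_dressedStep sgnK_sandwich unitS_antisymm)
open Summit.QuantumFields.BalabanUV.Beta.GAN24.TransportedWordReduction (tsum_prod_weight_vertexOfK_dressedStep_slotPsiS)
open Summit.QuantumFields.BalabanUV.Beta.GAN24.CombBorderWordTools (hasSum_sandwich_dressedStep_fm_col hasSum_sandwich_sgnK_dressedStep_fm_col tsum_prod_weight_fst_vertexOfK_dressedStep_slotPsiS
  sum_box_leftFamily_slotPsiS_eq)
open Summit.QuantumFields.BalabanUV.Beta.GAN24.CombVHEWordsZeroStep (sector_inr_left sector_inr_right exists_locStencil_sector sector_translate sector_antisymm vertexSector_translate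
  sectorCurrent_periodic exists_locStencil_transport_ScombOf transport_ScombOf_translate parityOdd_transport_ScombOf)
open Summit.QuantumFields.BalabanUV.Beta.GAN24.CombEVHWordsZeroStep (sum_box_leftFamily_face_eq_zero_of_divFree)

namespace Summit.QuantumFields.BalabanUV.Beta.GAN24.CombEVHSwapWordZeroStep

variable {d : ℕ} {Lc : ℕ} [NeZero Lc] {rb : Fin (d + 1) → ℕ}

/-! ## §1 Level `j+1`: the swap word over a transported border and the transported cubic sector, (D)∕(Z) displayed -/

section Words

variable {r : Fin (d + 1) → ℕ} {S' M : Fin (d + 1) → Site (d + 1) → MKer (d + 1) (Fib d)} {Cs δs CM δM : ℝ} {μ ν α β : Fin (d + 1)}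

/-- NOT IN PRINT; OUR BOOKKEEPING ([folklore]; (27) AT THE COMB DATA, LEVEL `j+1`, THE SWAP WORD, ZERO MODE, (D)∕(Z) DISPLAYED on the `β`-read current; the border's multiplier SECOND legs coarse).
`Σ_{c ∈ box Lc} Σ'_{u′} Σ'_{(y,w)} 𝟙f(y_α)𝟙f(w_β)·((vertexOfK X̃♮_{j+1} Lc (unitS (𝒯S′)) ν u′ ∘ X̃♮_{j+1}) ∘ vertexOfK X̃♮_{j+1} Lc (unitS (𝒯T)) μ c) y w (inl α)(inl β) = 0` — D2's swap route: per bond A1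
(outer legs drop), TRANSPOSITION (`tsum_twoFace_eq_trK`, `trK_comp`; the slot-transported sector vertex is leg-antisymmetric — A1 `trK_vertexOfK_unitS_slotPsiS` on C `sector_antisymm`; the sandwich
is `sgnK`-symmetric — A1 `trK_sandwich_dressedStep ∕ sgnK_sandwich`), leaf-04 `tsum_ffLeft_profile_right_word_eq` with the NEGATED charges (D1 `hasSum_sandwich_sgnK_dressedStep_fm_col`) and the
transposed slot, its first-leg-weighted resummed current untransported (D1 §2), `sum_neg_fmCharge_mul`, D1 §3 and `CombEVHWordsZeroStep` §1 with the left face `β`. -/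
theorem sum_box_transported_border_sector_swap_word_eq_zero_of_divFree (hLc : 1 ≤ Lc) (hrb : rb ∈ box (d + 1) Lc) (hr : r ∈ box (d + 1) Lc) (sf sm c₀ : ℝ) (j : ℕ)
    (hM : LocStencil M CM δM) (hδM : 0 < δM) (hMt : ∀ (κ : Fin (d + 1)) (u t : Site (d + 1)), M κ (u + (Lc : ℤ) • t) = shiftK (-((Lc : ℤ) • t)) (M κ u))
    (hMp : ∀ κ u, trK (M κ u) = -sgnK (M κ u))
    (hS' : LocStencil S' Cs δs) (hδs : 0 < δs) (hS'ff : ∀ (κ' : Fin (d + 1)) (t x z : Site (d + 1)) (α' a : Fin (d + 1)), S' κ' t x z (Sum.inl α') (Sum.inl a) = 0)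
    (hS'cov : ∀ (κ : Fin (d + 1)) (u t : Site (d + 1)), S' κ (u + (Lc : ℤ) • t) = shiftK (-((Lc : ℤ) • t)) (S' κ u))
    (hS'supp : ∀ (κ : Fin (d + 1)) (t z w : Site (d + 1)) (a : Fib d) (m : Fin (d + 1)), off Lc w ≠ 0 → S' κ t z w a (Sum.inr m) = 0)
    (hdiv' : ∀ p : Site (d + 1), ∑ b : Fin (d + 1),
      ((∑' uw : Site (d + 1) × Site (d + 1), (if uw.2 β % (Lc : ℤ) = (Lc : ℤ) - 1 then (1 : ℝ) else 0) *
        vertexOfK (unitK sf sm (coDressKBmAt (toSite rb) Lc (KInvStep (d := d) Lc (j + 1)))) Lc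
          (unitS sf sm (fun κ t => c₀ • e3OfK Lc (coDressKBmAt (toSite rb) Lc (KInvStep (d := d) Lc j)) M κ t)) μ uw.1 p uw.2 (Sum.inl b) (Sum.inl β)) -
       (∑' uw : Site (d + 1) × Site (d + 1), (if uw.2 β % (Lc : ℤ) = (Lc : ℤ) - 1 then (1 : ℝ) else 0) *
        vertexOfK (unitK sf sm (coDressKBmAt (toSite rb) Lc (KInvStep (d := d) Lc (j + 1)))) Lc
          (unitS sf sm (fun κ t => c₀ • e3OfK Lc (coDressKBmAt (toSite rb) Lc (KInvStep (d := d) Lc j)) M κ t)) μ uw.1 (p - unitVec b) uw.2 (Sum.inl b) (Sum.inl β))) = 0)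
    (h0' : ∀ b : Fin (d + 1), ∑ r' ∈ box (d + 1) Lc, ∑' uw : Site (d + 1) × Site (d + 1), (if uw.2 β % (Lc : ℤ) = (Lc : ℤ) - 1 then (1 : ℝ) else 0) *
        vertexOfK (unitK sf sm (coDressKBmAt (toSite rb) Lc (KInvStep (d := d) Lc (j + 1)))) Lc
          (unitS sf sm (fun κ t => c₀ • e3OfK Lc (coDressKBmAt (toSite rb) Lc (KInvStep (d := d) Lc j)) M κ t)) μ uw.1 (toSite r') uw.2 (Sum.inl b) (Sum.inl β) = 0) :
    ∑ c ∈ box (d + 1) Lc, ∑' u' : Site (d + 1), ∑' yw : Site (d + 1) × Site (d + 1), (if yw.1 α % (Lc : ℤ) = (Lc : ℤ) - 1 then (1 : ℝ) else 0) * (if yw.2 β % (Lc : ℤ) = (Lc : ℤ) - 1 then (1 : ℝ) else 0) *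
        comp (comp (vertexOfK (unitK sf sm (coDressKBmAt (toSite rb) Lc (KInvStep (d := d) Lc (j + 1)))) Lc
            (unitS sf sm (fun κ u => comp (comp (trK (psiKS r Lc)) (slotPsiS r Lc S' κ u)) (psiKS r Lc))) ν u')
          (unitK sf sm (coDressKBmAt (toSite rb) Lc (KInvStep (d := d) Lc (j + 1)))))
          (vertexOfK (unitK sf sm (coDressKBmAt (toSite rb) Lc (KInvStep (d := d) Lc (j + 1)))) Lc
            (unitS sf sm (fun κ u => comp (comp (trK (psiKS r Lc)) (slotPsiS r Lc
              (fun κ t => c₀ • e3OfK Lc (coDressKBmAt (toSite rb) Lc (KInvStep (d := d) Lc j)) M κ t) κ u)) (psiKS r Lc))) μ (toSite c)) yw.1 yw.2 (Sum.inl α) (Sum.inl β) = 0 := by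
  classical
  have hLc0 : 0 < Lc := hLc
  set X := unitK sf sm (coDressKBmAt (toSite rb) Lc (KInvStep (d := d) Lc (j + 1))) with hX
  set T : Fin (d + 1) → Site (d + 1) → MKer (d + 1) (Fib d) := fun κ t => c₀ • e3OfK Lc (coDressKBmAt (toSite rb) Lc (KInvStep (d := d) Lc j)) M κ t with hTdef
  set P' := vertexOfK X Lc (unitS sf sm (slotPsiS r Lc T)) μ with hP'def
  set R' := vertexOfK X Lc (unitS sf sm (slotPsiS r Lc S')) ν with hR'def
  -- common-rate data
  obtain ⟨δK, CK, hδK, hCK, hXd⟩ := decays_coDressKBmAt hLc hrb (decays_KInvStep (d := d) (Lc := Lc) (j + 1))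
  have hXu : Decays X (max |sf| |sm| * CK * max |sf| |sm|) δK := decays_unitK (sf := sf) (sm := sm) hXd
  have hCX : 0 ≤ max |sf| |sm| * CK * max |sf| |sm| := by positivity
  have hCs : 0 ≤ Cs := (hS' 0 0).nonneg (Sum.inl 0)
  obtain ⟨CT, δT, hδT, hT0⟩ := exists_locStencil_sector (rb := rb) (d := d) hrb c₀ j hM hδM
  have hCT : 0 ≤ CT := (hT0 0 0).nonneg (Sum.inl 0)
  set δ₁ : ℝ := min δK (min δs δT) with hδ₁
  have hδ₁0 : 0 < δ₁ := lt_min hδK (lt_min hδs hδT)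
  have hX1 : Decays X (max |sf| |sm| * CK * max |sf| |sm|) δ₁ := decays_mono hXu hCX le_rfl (min_le_left _ _)
  have hXspr : Spr X := ⟨_, _, hδ₁0, hX1⟩
  have hT1 : LocStencil T CT δ₁ := fun κ' u => biLoc_mono (hT0 κ' u) hCT ((min_le_right _ _).trans (min_le_right _ _))
  have hS1 : LocStencil S' Cs δ₁ := fun κ' u => biLoc_mono (hS' κ' u) hCs ((min_le_right _ _).trans (min_le_left _ _))
  have hTs := locStencil_slotPsiS (d := d) hLc0 r hT1 hδ₁0.le
  have hSs := locStencil_slotPsiS (d := d) hLc0 r hS1 hδ₁0.le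
  have hPf := vertexFamily_vertexOfK (N := Lc) hX1 hCX (locStencil_unitS (sf := sf) (sm := sm) hTs) hδ₁0 le_rfl
  have hQf := vertexFamily_vertexOfK (N := Lc) hX1 hCX (locStencil_unitS (sf := sf) (sm := sm) hSs) hδ₁0 le_rfl
  have hCp := (hPf μ 0).nonneg (Sum.inl 0)
  have hCq := (hQf μ 0).nonneg (Sum.inl 0)
  have h₁ : ∀ y : Site (d + 1), |(if y α % (Lc : ℤ) = (Lc : ℤ) - 1 then (1 : ℝ) else 0)| ≤ 1 := fun y => by split_ifs <;> simp
  have h₂ : ∀ w : Site (d + 1), |(if w β % (Lc : ℤ) = (Lc : ℤ) - 1 then (1 : ℝ) else 0)| ≤ 1 := fun w => by split_ifs <;> simp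
  have hSscov : ∀ (κ : Fin (d + 1)) (u t : Site (d + 1)), slotPsiS r Lc S' κ (u + (Lc : ℤ) • t) = shiftK (-((Lc : ℤ) • t)) (slotPsiS r Lc S' κ u) :=
    fun κ u t => slotPsiS_shift hLc0 r hS'cov κ u t
  have hTcov : ∀ (κ : Fin (d + 1)) (u t : Site (d + 1)), T κ (u + (Lc : ℤ) • t) = shiftK (-((Lc : ℤ) • t)) (T κ u) :=
    fun κ u t => by rw [hTdef]; exact sector_translate (rb := rb) (d := d) c₀ j hMt κ u ((Lc : ℤ) • t)
  have hTfm : ∀ (κ' : Fin (d + 1)) (t x z : Site (d + 1)) (α' m : Fin (d + 1)), T κ' t x z (Sum.inl α') (Sum.inr m) = 0 :=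
    fun κ' t x z α' m => by rw [hTdef]; exact sector_inr_right (rb := rb) (d := d) c₀ j κ' t x z (Sum.inl α') m
  have hTanti : ∀ (κ' : Fin (d + 1)) (u x z : Site (d + 1)) (a b : Fib d), T κ' u z x b a = -T κ' u x z a b :=
    fun κ' u x z a b => by rw [hTdef]; exact sector_antisymm (rb := rb) (d := d) hrb c₀ j hM hδM hMp κ' u x z a b
  -- the transposed middle kernel: `trK (Ψ̂XΨ̂ᵀ) = Ψ̂ (sgnK X) Ψ̂ᵀ`
  have hYt : trK (comp (comp (psiKS r Lc) X) (trK (psiKS r Lc))) = comp (comp (psiKS r Lc) (sgnK X)) (trK (psiKS r Lc)) := by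
    rw [hX, trK_sandwich_dressedStep hLc0 hr hLc hrb sf sm (j + 1), sgnK_sandwich]
  obtain ⟨CY, hCY, hY⟩ := exists_decays_sandwich hLc0 hr (decays_sgnK hX1) hδ₁0
  have hPt : ∀ c : Site (d + 1), trK (P' c) = -P' c := fun c =>
    trK_vertexOfK_unitS_slotPsiS r Lc X Lc sf sm hTanti μ c
  have hTP : ∀ c : Site (d + 1), Tame (P' c) := fun c => Loc.tame ⟨_, _, _, _, half_pos hδ₁0, hPf μ c⟩
  have hTY : Tame (comp (comp (psiKS r Lc) (sgnK X)) (trK (psiKS r Lc))) := (spr_sandwich hLc0 hr ⟨_, _, hδ₁0, decays_sgnK hX1⟩).tame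
  have hTR : ∀ u' : Site (d + 1), Tame (trK (R' u')) := fun u' => Loc.tame ⟨_, _, _, _, half_pos hδ₁0, biLoc_trK (hQf ν u')⟩
  -- per cell bond
  have hval : ∀ c : Site (d + 1), (∑' u' : Site (d + 1), ∑' yw : Site (d + 1) × Site (d + 1), (if yw.1 α % (Lc : ℤ) = (Lc : ℤ) - 1 then (1 : ℝ) else 0) * (if yw.2 β % (Lc : ℤ) = (Lc : ℤ) - 1 then (1 : ℝ) else 0) *
        comp (comp (vertexOfK X Lc (unitS sf sm (fun κ u => comp (comp (trK (psiKS r Lc)) (slotPsiS r Lc S' κ u)) (psiKS r Lc))) ν u') X)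
          (vertexOfK X Lc (unitS sf sm (fun κ u => comp (comp (trK (psiKS r Lc)) (slotPsiS r Lc T κ u)) (psiKS r Lc))) μ c) yw.1 yw.2 (Sum.inl α) (Sum.inl β)) =
      -∑' y₁ : Site (d + 1), ∑ a : Fin (d + 1), (∑' y : Site (d + 1), (if y β % (Lc : ℤ) = (Lc : ℤ) - 1 then (1 : ℝ) else 0) * P' c y y₁ (Sum.inl β) (Sum.inl a)) *
        ((if y₁ a % (Lc : ℤ) = (Lc : ℤ) - 1 then (1 : ℝ) else 0) * (-(((Lc : ℝ) * (sm * sf)) * ((((Lc ^ (j + 1 + 1) : ℕ) : ℝ)) ^ (d + 1 + 1))⁻¹ *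
          (∑' uw : Site (d + 1) × Site (d + 1), (if uw.2 α % (Lc : ℤ) = (Lc : ℤ) - 1 then (1 : ℝ) else 0) * vertexOfK X Lc (unitS sf sm S') ν uw.1 uw.2 0 (Sum.inl α) (Sum.inr a))))) := by
    intro c
    -- (i) transports out, outer legs drop; (ii) transposition
    have e : ∀ u' : Site (d + 1), (∑' yw : Site (d + 1) × Site (d + 1), (if yw.1 α % (Lc : ℤ) = (Lc : ℤ) - 1 then (1 : ℝ) else 0) * (if yw.2 β % (Lc : ℤ) = (Lc : ℤ) - 1 then (1 : ℝ) else 0) *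
          comp (comp (vertexOfK X Lc (unitS sf sm (fun κ u => comp (comp (trK (psiKS r Lc)) (slotPsiS r Lc S' κ u)) (psiKS r Lc))) ν u') X)
            (vertexOfK X Lc (unitS sf sm (fun κ u => comp (comp (trK (psiKS r Lc)) (slotPsiS r Lc T κ u)) (psiKS r Lc))) μ c) yw.1 yw.2 (Sum.inl α) (Sum.inl β)) =
        -∑' wy : Site (d + 1) × Site (d + 1), (if wy.1 β % (Lc : ℤ) = (Lc : ℤ) - 1 then (1 : ℝ) else 0) * (if wy.2 α % (Lc : ℤ) = (Lc : ℤ) - 1 then (1 : ℝ) else 0) *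
          comp (comp (P' c) (comp (comp (psiKS r Lc) (sgnK X)) (trK (psiKS r Lc)))) (trK (R' u')) wy.1 wy.2 (Sum.inl β) (Sum.inl α) := by
      intro u'
      rw [vertexOfK_unitS_transport_eq_conj hLc0 hr hXspr sf sm hS1 hδ₁0 ν u', vertexOfK_unitS_transport_eq_conj hLc0 hr hXspr sf sm hT1 hδ₁0 μ c,
        tsum_twoFace_conj_word_eq hLc0 hr (hQf ν u') (half_pos hδ₁0) (hPf μ c) (half_pos hδ₁0) hX1 hδ₁0 h₁ (fun y s => face_weight_periodic Lc α y s) h₂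
          (fun w s => face_weight_periodic Lc β w s) _ _]
      refine (tsum_twoFace_eq_trK (comp (comp (R' u') (comp (comp (psiKS r Lc) X) (trK (psiKS r Lc)))) (P' c)) (fun y : Site (d + 1) => (if y α % (Lc : ℤ) = (Lc : ℤ) - 1 then (1 : ℝ) else 0))
        (fun w : Site (d + 1) => (if w β % (Lc : ℤ) = (Lc : ℤ) - 1 then (1 : ℝ) else 0)) (Sum.inl α) (Sum.inl β)).trans ?_
      rw [trK_comp, trK_comp, hYt, hPt c, comp_neg_left, comp_assoc_tame (hTP c) hTY (hTR u'), ← tsum_neg]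
      exact tsum_congr fun wy => by simp only [Pi.neg_apply]; ring
    rw [tsum_congr e, tsum_neg]
    congr 1
    -- (iii) leaf-04's reduction with the negated charges and the transposed slot
    have hP8 : BiLoc (P' c) ((Lc : ℤ) • c) ((Lc : ℤ) • c) _ (δ₁ / 8) := biLoc_mono (hPf μ c) hCp (by linarith)
    have hA := biLoc_comp_right (biLoc_mono (hPf μ c) hCp (show δ₁ / 4 ≤ δ₁ / 2 by linarith)) hY (show (0 : ℝ) ≤ δ₁ / 8 by positivity) (by linarith)
    rw [tsum_ffLeft_profile_right_word_eq (N := Lc) (α := β) (β := α) (Q := fun u' => trK (R' u'))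
      (ρ₁ := fun w : Site (d + 1) => (if w β % (Lc : ℤ) = (Lc : ℤ) - 1 then (1 : ℝ) else 0))
      (ρ₂ := fun y : Site (d + 1) => (if y α % (Lc : ℤ) = (Lc : ℤ) - 1 then (1 : ℝ) else 0)) (show (0 : ℝ) < δ₁ / 8 by positivity) hP8
      (fun y z α' m => by rw [hP'def]; exact vertexOfK_unitS_slotPsiS_entry_eq_zero r X Lc sf sm (fun κ t x z' => hTfm κ t x z' α' m) μ c y z)
      (decays_mono hY hCY le_rfl (by linarith))
      (fun y₁ a m => by rw [hX]; exact hasSum_sandwich_sgnK_dressedStep_fm_col hLc0 hr hLc hrb sf sm (j + 1) y₁ a m) hA (fun u => biLoc_trK (biLoc_mono (hQf ν u) hCq (by linarith)))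
      (fun u s => by show trK (R' (u + s)) = _; rw [hR'def, hX, borderSlot_translate (r := rb) hLc sf sm (j + 1) hSscov ν u s]; rfl)
      (fun u z w b' b => by rw [trK_apply]; exact vertexOfK_unitS_slotPsiS_entry_eq_zero r X Lc sf sm (fun κ t x z' => hS'ff κ t x z' b b') ν u w z)
      (fun u z w m b hz => by rw [trK_apply]; exact borderSlot_inr_snd_eq_zero X sf sm (slotPsiS_inr_snd_supp (Lc := Lc) r hS'supp) ν u w z b m hz) h₂ h₁
      (fun w s => face_weight_periodic Lc α w s)]
    refine tsum_congr fun y₁ => Finset.sum_congr rfl fun a _ => ?_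
    congr 1
    -- (iv) the first-leg-weighted resummed multiplier current of the slot-transported border is the untransported one
    have et : ∀ m : Fin (d + 1), (∑' uw : Site (d + 1) × Site (d + 1), (if uw.2 α % (Lc : ℤ) = (Lc : ℤ) - 1 then (1 : ℝ) else 0) * trK (R' uw.1) 0 uw.2 (Sum.inr m) (Sum.inl α))
        = ∑' uw : Site (d + 1) × Site (d + 1), (if uw.2 α % (Lc : ℤ) = (Lc : ℤ) - 1 then (1 : ℝ) else 0) * vertexOfK X Lc (unitS sf sm S') ν uw.1 uw.2 0 (Sum.inl α) (Sum.inr m) := by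
      intro m
      simp only [trK_apply, hR'def]
      rw [hX]
      exact tsum_prod_weight_fst_vertexOfK_dressedStep_slotPsiS hLc hrb sf sm (j + 1) ν r hS' hδs h₁ 0 (Sum.inl α) (Sum.inr m)
    simp only [et]
    exact sum_neg_fmCharge_mul (d := d) Lc sf sm (((((Lc ^ (j + 1 + 1) : ℕ) : ℝ)) ^ (d + 1 + 1))⁻¹)
      (fun m => ∑' uw : Site (d + 1) × Site (d + 1), (if uw.2 α % (Lc : ℤ) = (Lc : ℤ) - 1 then (1 : ℝ) else 0) * vertexOfK X Lc (unitS sf sm S') ν uw.1 uw.2 0 (Sum.inl α) (Sum.inr m)) y₁ a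
  simp only [hP'def, hX] at hval
  rw [Finset.sum_congr rfl fun c _ => hval (toSite c), Finset.sum_neg_distrib, neg_eq_zero]
  -- (v) the cell sum
  have hAb : ∀ (a : Fin (d + 1)) (y : Site (d + 1)), |(if y a % (Lc : ℤ) = (Lc : ℤ) - 1 then (1 : ℝ) else 0) * (-(((Lc : ℝ) * (sm * sf)) * ((((Lc ^ (j + 1 + 1) : ℕ) : ℝ)) ^ (d + 1 + 1))⁻¹ *
      (∑' uw : Site (d + 1) × Site (d + 1), (if uw.2 α % (Lc : ℤ) = (Lc : ℤ) - 1 then (1 : ℝ) else 0) *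
        vertexOfK (unitK sf sm (coDressKBmAt (toSite rb) Lc (KInvStep (d := d) Lc (j + 1)))) Lc (unitS sf sm S') ν uw.1 uw.2 0 (Sum.inl α) (Sum.inr a))))| ≤
      ∑ a' : Fin (d + 1), |-(((Lc : ℝ) * (sm * sf)) * ((((Lc ^ (j + 1 + 1) : ℕ) : ℝ)) ^ (d + 1 + 1))⁻¹ *
        (∑' uw : Site (d + 1) × Site (d + 1), (if uw.2 α % (Lc : ℤ) = (Lc : ℤ) - 1 then (1 : ℝ) else 0) *
          vertexOfK (unitK sf sm (coDressKBmAt (toSite rb) Lc (KInvStep (d := d) Lc (j + 1)))) Lc (unitS sf sm S') ν uw.1 uw.2 0 (Sum.inl α) (Sum.inr a')))| := by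
    intro a y
    have h1 : |(if y a % (Lc : ℤ) = (Lc : ℤ) - 1 then (1 : ℝ) else 0) * (-(((Lc : ℝ) * (sm * sf)) * ((((Lc ^ (j + 1 + 1) : ℕ) : ℝ)) ^ (d + 1 + 1))⁻¹ *
        (∑' uw : Site (d + 1) × Site (d + 1), (if uw.2 α % (Lc : ℤ) = (Lc : ℤ) - 1 then (1 : ℝ) else 0) *
          vertexOfK (unitK sf sm (coDressKBmAt (toSite rb) Lc (KInvStep (d := d) Lc (j + 1)))) Lc (unitS sf sm S') ν uw.1 uw.2 0 (Sum.inl α) (Sum.inr a))))| ≤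
        |-(((Lc : ℝ) * (sm * sf)) * ((((Lc ^ (j + 1 + 1) : ℕ) : ℝ)) ^ (d + 1 + 1))⁻¹ *
          (∑' uw : Site (d + 1) × Site (d + 1), (if uw.2 α % (Lc : ℤ) = (Lc : ℤ) - 1 then (1 : ℝ) else 0) *
            vertexOfK (unitK sf sm (coDressKBmAt (toSite rb) Lc (KInvStep (d := d) Lc (j + 1)))) Lc (unitS sf sm S') ν uw.1 uw.2 0 (Sum.inl α) (Sum.inr a)))| := by
      rw [abs_mul]; exact mul_le_of_le_one_left (abs_nonneg _) (by split_ifs <;> simp)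
    exact h1.trans (Finset.single_le_sum (f := fun a' => |-(((Lc : ℝ) * (sm * sf)) * ((((Lc ^ (j + 1 + 1) : ℕ) : ℝ)) ^ (d + 1 + 1))⁻¹ *
        (∑' uw : Site (d + 1) × Site (d + 1), (if uw.2 α % (Lc : ℤ) = (Lc : ℤ) - 1 then (1 : ℝ) else 0) *
          vertexOfK (unitK sf sm (coDressKBmAt (toSite rb) Lc (KInvStep (d := d) Lc (j + 1)))) Lc (unitS sf sm S') ν uw.1 uw.2 0 (Sum.inl α) (Sum.inr a')))|)
      (fun _ _ => abs_nonneg _) (Finset.mem_univ a))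
  have hAp : ∀ (a : Fin (d + 1)) (y s : Site (d + 1)), (if (y + (Lc : ℤ) • s) a % (Lc : ℤ) = (Lc : ℤ) - 1 then (1 : ℝ) else 0) * (-(((Lc : ℝ) * (sm * sf)) * ((((Lc ^ (j + 1 + 1) : ℕ) : ℝ)) ^ (d + 1 + 1))⁻¹ *
      (∑' uw : Site (d + 1) × Site (d + 1), (if uw.2 α % (Lc : ℤ) = (Lc : ℤ) - 1 then (1 : ℝ) else 0) *
        vertexOfK (unitK sf sm (coDressKBmAt (toSite rb) Lc (KInvStep (d := d) Lc (j + 1)))) Lc (unitS sf sm S') ν uw.1 uw.2 0 (Sum.inl α) (Sum.inr a)))) =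
      (if y a % (Lc : ℤ) = (Lc : ℤ) - 1 then (1 : ℝ) else 0) * (-(((Lc : ℝ) * (sm * sf)) * ((((Lc ^ (j + 1 + 1) : ℕ) : ℝ)) ^ (d + 1 + 1))⁻¹ *
      (∑' uw : Site (d + 1) × Site (d + 1), (if uw.2 α % (Lc : ℤ) = (Lc : ℤ) - 1 then (1 : ℝ) else 0) *
        vertexOfK (unitK sf sm (coDressKBmAt (toSite rb) Lc (KInvStep (d := d) Lc (j + 1)))) Lc (unitS sf sm S') ν uw.1 uw.2 0 (Sum.inl α) (Sum.inr a)))) :=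
    fun a y s => by rw [face_weight_periodic Lc a y s]
  rw [sum_box_leftFamily_slotPsiS_eq (μ := μ) (γ := β) hLc hrb sf sm (j + 1) r hT0 hδT hTcov hAb hAp]
  exact sum_box_leftFamily_face_eq_zero_of_divFree (rb := rb) hrb sf sm c₀ j hM hδM hMt hMp μ β hdiv' h0' _

end Words

/-! ## §2 At the comb data -/

section Comb

variable {μ ν α β : Fin (d + 1)}

/-- NOT IN PRINT; OUR BOOKKEEPING ([folklore]; (27)_comb AT LEVEL `j+1`, THE SWAP WORD — F6's `V^VH′_{u′} ⊗ V^E′_cb` word at an1's record, (D)∕(Z) on the `β`-read current; §1 at `r = rb = ctrOff (d+1) Lc`, `M = 𝒯 S̃comb_j`). -/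
theorem comb_VHe_swap_word_succ_eq_zero_of_divFree (sf sm cΛt cE cVH cΛ c : ℝ) (j : ℕ)
    (hdiv' : ∀ p : Site (d + 1), ∑ b : Fin (d + 1),
      ((∑' uw : Site (d + 1) × Site (d + 1), (if uw.2 β % (Lc : ℤ) = (Lc : ℤ) - 1 then (1 : ℝ) else 0) *
        vertexOfK (unitK sf sm (coDressKBmAt (ctr (d + 1) Lc) Lc (KInvStep (d := d) Lc (j + 1)))) Lc
          (unitS sf sm (fun κ t => (cE * wE d Lc (j + 1)) • e3OfK Lc (coDressKBmAt (ctr (d + 1) Lc) Lc (KInvStep (d := d) Lc j))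
            (fun κ u => comp (comp (trK (psiKS (ctrOff (d + 1) Lc) Lc)) (slotPsiS (ctrOff (d + 1) Lc) Lc (ScombOf (symTablesAn1S2 d Lc cΛt) cE cVH cΛ j) κ u))
              (psiKS (ctrOff (d + 1) Lc) Lc)) κ t)) μ uw.1 p uw.2 (Sum.inl b) (Sum.inl β)) -
       (∑' uw : Site (d + 1) × Site (d + 1), (if uw.2 β % (Lc : ℤ) = (Lc : ℤ) - 1 then (1 : ℝ) else 0) *
        vertexOfK (unitK sf sm (coDressKBmAt (ctr (d + 1) Lc) Lc (KInvStep (d := d) Lc (j + 1)))) Lc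
          (unitS sf sm (fun κ t => (cE * wE d Lc (j + 1)) • e3OfK Lc (coDressKBmAt (ctr (d + 1) Lc) Lc (KInvStep (d := d) Lc j))
            (fun κ u => comp (comp (trK (psiKS (ctrOff (d + 1) Lc) Lc)) (slotPsiS (ctrOff (d + 1) Lc) Lc (ScombOf (symTablesAn1S2 d Lc cΛt) cE cVH cΛ j) κ u))
              (psiKS (ctrOff (d + 1) Lc) Lc)) κ t)) μ uw.1 (p - unitVec b) uw.2 (Sum.inl b) (Sum.inl β))) = 0)
    (h0' : ∀ b : Fin (d + 1), ∑ r' ∈ box (d + 1) Lc, ∑' uw : Site (d + 1) × Site (d + 1), (if uw.2 β % (Lc : ℤ) = (Lc : ℤ) - 1 then (1 : ℝ) else 0) *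
        vertexOfK (unitK sf sm (coDressKBmAt (ctr (d + 1) Lc) Lc (KInvStep (d := d) Lc (j + 1)))) Lc
          (unitS sf sm (fun κ t => (cE * wE d Lc (j + 1)) • e3OfK Lc (coDressKBmAt (ctr (d + 1) Lc) Lc (KInvStep (d := d) Lc j))
            (fun κ u => comp (comp (trK (psiKS (ctrOff (d + 1) Lc) Lc)) (slotPsiS (ctrOff (d + 1) Lc) Lc (ScombOf (symTablesAn1S2 d Lc cΛt) cE cVH cΛ j) κ u))
              (psiKS (ctrOff (d + 1) Lc) Lc)) κ t)) μ uw.1 (toSite r') uw.2 (Sum.inl b) (Sum.inl β) = 0) :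
    ∑ cb ∈ box (d + 1) Lc, ∑' u' : Site (d + 1), ∑' yw : Site (d + 1) × Site (d + 1), (if yw.1 α % (Lc : ℤ) = (Lc : ℤ) - 1 then (1 : ℝ) else 0) * (if yw.2 β % (Lc : ℤ) = (Lc : ℤ) - 1 then (1 : ℝ) else 0) *
        comp (comp (vertexOfK (unitK sf sm (coDressKBmAt (ctr (d + 1) Lc) Lc (KInvStep (d := d) Lc (j + 1)))) Lc
            (unitS sf sm (fun κ v => comp (comp (trK (psiKS (ctrOff (d + 1) Lc) Lc))
              (slotPsiS (ctrOff (d + 1) Lc) Lc (fun κ v => c • symVhSAt (ctr (d + 1) Lc) d Lc rfl κ v) κ v)) (psiKS (ctrOff (d + 1) Lc) Lc))) ν u')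
          (unitK sf sm (coDressKBmAt (ctr (d + 1) Lc) Lc (KInvStep (d := d) Lc (j + 1)))))
          (vertexOfK (unitK sf sm (coDressKBmAt (ctr (d + 1) Lc) Lc (KInvStep (d := d) Lc (j + 1)))) Lc
            (unitS sf sm (fun κ u => comp (comp (trK (psiKS (ctrOff (d + 1) Lc) Lc)) (slotPsiS (ctrOff (d + 1) Lc) Lc
              (fun κ t => (cE * wE d Lc (j + 1)) • e3OfK Lc (coDressKBmAt (ctr (d + 1) Lc) Lc (KInvStep (d := d) Lc j))
            (fun κ u => comp (comp (trK (psiKS (ctrOff (d + 1) Lc) Lc)) (slotPsiS (ctrOff (d + 1) Lc) Lc (ScombOf (symTablesAn1S2 d Lc cΛt) cE cVH cΛ j) κ u))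
              (psiKS (ctrOff (d + 1) Lc) Lc)) κ t) κ u)) (psiKS (ctrOff (d + 1) Lc) Lc))) μ (toSite cb))
          yw.1 yw.2 (Sum.inl α) (Sum.inl β) = 0 := by
  have hLc : 1 ≤ Lc := Nat.one_le_iff_ne_zero.mpr (NeZero.ne Lc)
  obtain ⟨CM, δM, hδM, hM⟩ := exists_locStencil_transport_ScombOf (d := d) (Lc := Lc) cΛt cE cVH cΛ j
  exact sum_box_transported_border_sector_swap_word_eq_zero_of_divFree (μ := μ) (ν := ν) (α := α) (β := β) hLc (ctrOff_mem_box (pos_Lc (Lc := Lc))) (ctrOff_mem_box (pos_Lc (Lc := Lc)))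
    sf sm (cE * wE d Lc (j + 1)) j hM hδM (fun κ u t => transport_ScombOf_translate (d := d) (Lc := Lc) cΛt cE cVH cΛ j κ u t)
    (fun κ u => parityOdd_transport_ScombOf (d := d) (Lc := Lc) cΛt cE cVH cΛ j κ u)
    (locStencil_symVhS (Lc := Lc) c zero_le_one) one_pos (fun κ' t x z α' a => symVhS_inl_inl (Lc := Lc) c κ' t x z α' a) (fun κ u t => symVhS_translate hLc c κ u t)
    (fun κ t z w a m hw => symVhS_inr_snd_eq_zero (Lc := Lc) c κ t z w a m hw) hdiv' h0'

end Comb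

end Summit.QuantumFields.BalabanUV.Beta.GAN24.CombEVHSwapWordZeroStep

end
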